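import Summits.QuantumFields.QCD.Theses.QuarkMassMonotone
import HarnessLib.Audit

/-!
# Birth skeleton (BC3) for the crux `LatticeGapMonotone` (item stmt-QuantumFields-8905)

Route `QuarkMassMonotone` (sub-problem QCD), crux decl
`Summit.QuantumFields.QCD.Theses.QuarkMassMonotone.LatticeGapMonotone` (rank 2, the route's net content):

  `∀ N_f reg (m ≤ m' componentwise) Δ, RayCertificate reg m →
     (reg.scheme m 0 0).HasLatticeMassGap Δ → (reg.scheme m' 0 0).HasLatticeMassGap Δ`

("heavier quarks never refine the lattice": at the SAME couplings `β_k`, componentwise-heavier renormalised quark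
masses keep every uniform lattice gap `Δ`, with no loss of rate, PROVIDED the lighter tuple `m` carries the
physical-branch certificate — eventually in `k`, every flavour-blind upward shift `t ≥ 0` of `m`'s bare tuple
clusters `S`-uniformly at some lattice rate `δ(k,t) > 0`).

Registered by the skeleton-registrar seat `planner-skel-stmt-QuantumFields-8905-0` (route re-audit bin REPAIRABLE,
2026-08-17) as `Cruxes/LatticeGapMonotone/Lines/birth.lean`.  It is the route-level BIRTH CERTIFICATE of the crux
(≥ 2 named stubs, a kernel-checked composition concluding the crux BY NAME, `sorry` only inside `stub_*`), cut along
the route header's own reading of the node — the certificate is a PHASE LABEL of the starting tuple, the gap is moved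
up the COMPONENTWISE order by the Feynman–Hellmann sign in each bare mass ("UniformDomination … plus the
(−1)^F-twisted finite-torus bookkeeping and Cauchy–Schwarz to pass from diagonal to general pairs", header TWO-LAYER
PLAN), which needs the massive phase along the whole mass SEGMENT `[m(k), m'(k)]`, not only on the flavour-blind ray
above `m(k)` — into three pieces typed over the Statement's own vocabulary (`QCDRegularisation.scheme`,
`QCDScheme.HasLatticeMassGap`, `QCDLatticeObservable`, `qcdLatticeConnectedCorr`):

* `stub_massivePhaseUpSet : Stmt.stub_massivePhaseUpSet` (phase structure; size L / open at weak coupling) — the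
  certified massive phase is an UP-SET of the componentwise order: `m ≤ m''` and `RayCertificate reg m` give
  `RayCertificate reg m''`.  Trivial for flavour-BLIND raises (the ray above `m''(k)` lies inside the ray above
  `m(k)`), genuine for split raises (e.g. `N_f = 2 → 1 + heavy`: the ray above the split tuple runs through a
  different part of the Wilson phase diagram).
* `stub_segmentUniformity : Stmt.stub_segmentUniformity` (stability / compactness; size M–L) — pointwise ray
  certificates at every tuple of the order segment `[m, m']` UNIFORMISE: one `k₀`, and at each `k ≥ k₀` one lattice
  rate `δ_k > 0` and per-pair constants `(C, S₀)` valid for every `m'' ∈ [m, m']` at once (`SegmentCertificate`).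
  Clustering is an open condition with locally uniform constants (perturbation of a massive lattice theory in the
  bare mass, `S`-uniformly) and the segment is compact; the `k`-uniformity of the threshold is the non-soft part.
* `stub_uniformDomination : Stmt.stub_uniformDomination` (the analytic heart — the header's layer-2 node
  UniformDomination with the sea and valence signs folded in; size XL) — along a uniformly certified segment,
  every connected correlator at the heavier tuple is DOMINATED, eventually in `k`, on every torus `2S+1 ≥ 2L_k+1` and
  for all `n ≤ S`, by `K` times a finite sum of norms of connected correlators at the lighter tuple at the same
  `(k, S, n)`, with `K` and the dominating family independent of `(k, S, n)` (`UniformlyDominated`).  Rate-free: it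
  transports EVERY rate `Δ` without loss, which is exactly what the crux asserts.

`LatticeGapMonotone_of : Stmt.stub_massivePhaseUpSet → Stmt.stub_segmentUniformity → Stmt.stub_uniformDomination →
LatticeGapMonotone` is kernel-checked: the crux's hypothesis IS `RayCertificate reg m` (definitionally); the up-set
stub spreads it over the segment `[m, m']`; the uniformity stub turns the pointwise certificates into a
`SegmentCertificate`; the domination stub yields `UniformlyDominated reg m m'`; and the proved bookkeeping lemma
`hasLatticeMassGap_of_dominated` (finite sums under `∀ᶠ k`, `Filter.eventually_all`; the scheme fields `β, L, a` of
`reg.scheme m 0 0` and `reg.scheme m' 0 0` agree definitionally) moves the gap `Δ` from `m` to `m'` with constant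
`K · ∑ᵢ Cᵢ`.  All three stubs are load-bearing (pairwise probes in the seat's folder).

## Negative knowledge honoured (read 2026-08-17)
* `Cruxes/LatticeGapMonotone/` had NO workfiles before this one (no `Disproof.lean`, no crux ideas, no dead lines);
  the crux's notes are the grounder's (g15-33: NEW, no monotonicity-in-mass theorem in print) and three refuter
  route reviews (rreview-0815T13-6 g0/g3, rreview1 2026-08-16: checked, survives; corners: `N_f = 0` trivially true,
  doubler branch / supercritical `κ` / `N_f = 1` below its endpoint REVERSE the order but are excluded by the
  `∀ t ≥ 0` ray certificate; as typed `β_k`, `N_f`, `sign m_f`, `Δ ≤ 0` are free).  The stubs keep exactly the crux's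
  generality (no `HasMassScaling`, no `0 < m_f`, no `0 < Δ` added), so the composition needs no side conditions; the
  why-it-might-fail lines record where that generality bites (bare increments `a_k(m'_f − m_f)/Z_m(k)` need not tend
  to `0` without `HasMassScaling`).
* No bespoke admissibility predicate is introduced (the failure mode of the summit's refuted engine items): the
  three currency predicates `ClustersAt` / `SegmentCertificate` / `UniformlyDominated` are built from the crux's own
  matrix (`qcdLatticeConnectedCorr` bounds) and nothing else.
* Junk corners: where the fermionic partition function vanishes on a torus (signed odd-`N_f` Wilson weight)
  `qcdTorusExpect` is junk `0` — at the LIGHTER tuple this makes the dominating family vanish at that `(k, S)`, so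
  `UniformlyDominated` then demands the heavier correlator vanish too: recorded under `stub_uniformDomination` as a
  why-it-might-fail (the crux itself only needs the exponential envelope there).  `N_f = 0`: `m = m'`, every stub and
  the crux hold trivially (`latticeGapMonotone_nf_zero` below, BC5-in-kind).
* Typing checklist 4c: no Bochner integral over a free function is introduced, no hand-picked threshold or rate
  (`δ, C, S₀, K, N` existential), no determinantal / complex-action positivity claim.

## BC3 probes (planner folder `bc/`): for each stub statement `S`, `S → LatticeGapMonotone` and `S → QCD` by
`first | exact? | simpa [S] | (unfold S; simpa) | aesop` FAIL (files `bc/probe_<stub>.lean`, statements copied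
verbatim with no stub theorem or composition in scope; rc and goals in the seat's NOTES.md and in `Lines/birth.md`).
-/

noncomputable section

namespace Summit.QuantumFields.QCD.Cruxes.LatticeGapMonotone.Birth

open scoped BigOperators Topology Classical
open MeasureTheory Filter
open Literature.MathematicalPhysics.QuantumFieldTheory
open Summit.QuantumFields.QCD.Theses.QuarkMassMonotone

/-! ## §0 Currency (the crux's own matrix, named) -/

/-- **`S`-uniform exponential clustering at lattice rate `δ`** of ALL pairs of gauge-invariant local lattice QCD
observables at inverse bare coupling `β` and bare Wilson masses `mq` (per-pair constant `C` and volume threshold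
`S₀`; tori `2S+1 ≥ 2S₀+1`, Euclidean-time separations `n ≤ S`): the matrix of the route's physical-branch
certificate. [folklore] -/
def ClustersAt (Nf : ℕ) (β : ℝ) (mq : Fin Nf → ℝ) (δ : ℝ) : Prop :=
  ∀ (R R' : ℕ) (A : QCDLatticeObservable Nf R) (B : QCDLatticeObservable Nf R'),
    ∃ (C : ℝ) (S₀ : ℕ), ∀ S : ℕ, S₀ ≤ S → ∀ n : ℕ, n ≤ S →
      ‖qcdLatticeConnectedCorr β (2 * S + 1) mq A B n‖ ≤ C * Real.exp (-(δ * n))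

/-- **The physical-branch (RAY) certificate of the renormalised tuple `m` in `reg`** — verbatim the hypothesis of
the crux (definitionally): eventually in `k`, every flavour-blind upward shift `t ≥ 0` of `m`'s bare tuple
`m_f(k) = m_crit(k) + a_k m_f / Z_m(k)` clusters `S`-uniformly at some lattice rate `δ(k, t) > 0` at the coupling
`β_k`: the non-circular certificate that `m` sits on the PHYSICAL Wilson branch (connected to the heavy corner), not
on a doubler branch where the order provably reverses. [folklore] -/
def RayCertificate (Nf : ℕ) (reg : QCDRegularisation Nf) (m : Fin Nf → ℝ) : Prop :=
  ∀ᶠ k in atTop, ∀ t : ℝ, 0 ≤ t → ∃ δ : ℝ, 0 < δ ∧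
    ClustersAt Nf (reg.β k) (fun f => (reg.scheme m 0 0).mq f k + t) δ

/-- **Uniform certificate of the order segment `[m, m']` in `reg`**: ONE threshold `k₀` and, at each `k ≥ k₀`, ONE
lattice rate `δ_k > 0` and per-pair constants `(C, S₀)` such that EVERY tuple `m''` with `m ≤ m'' ≤ m'`
componentwise clusters: `‖⟨A·τ_nB⟩ − ⟨A⟩⟨B⟩‖ ≤ C e^{−δ_k n}` at `β_k` and bare masses `m''_f(k)`, on all tori
`2S+1 ≥ 2S₀+1`, `n ≤ S` — the form in which a Feynman–Hellmann integration along the segment consumes the massive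
phase. [folklore] -/
def SegmentCertificate (Nf : ℕ) (reg : QCDRegularisation Nf) (m m' : Fin Nf → ℝ) : Prop :=
  ∀ᶠ k in atTop, ∃ δ : ℝ, 0 < δ ∧
    ∀ (R R' : ℕ) (A : QCDLatticeObservable Nf R) (B : QCDLatticeObservable Nf R'),
      ∃ (C : ℝ) (S₀ : ℕ), ∀ m'' : Fin Nf → ℝ, (∀ f, m f ≤ m'' f) → (∀ f, m'' f ≤ m' f) →
        ∀ S : ℕ, S₀ ≤ S → ∀ n : ℕ, n ≤ S →
          ‖qcdLatticeConnectedCorr (reg.β k) (2 * S + 1) (fun f => (reg.scheme m'' 0 0).mq f k) A B n‖ ≤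
            C * Real.exp (-(δ * n))

/-- **Uniform domination of the heavier tuple `m'` by the lighter tuple `m` along `reg`** (the header's layer-2 node
UniformDomination, typed rate-free): for every pair `(A, B)` there are finitely many pairs `(A_i, B_i)_{i < N}` and a
constant `K ≥ 0`, independent of `(k, S, n)`, such that for all large `k`, on every torus `2S+1 ≥ 2L_k+1` and for all
`n ≤ S`, `‖⟨A·τ_nB⟩^c_{m'(k)}‖ ≤ K ∑_i ‖⟨A_i·τ_nB_i⟩^c_{m(k)}‖` at the common coupling `β_k` (written through the two
schemes' own fields, which agree with `reg`'s definitionally, so that the predicate plugs into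
`QCDScheme.HasLatticeMassGap` verbatim). [folklore] -/
def UniformlyDominated (Nf : ℕ) (reg : QCDRegularisation Nf) (m m' : Fin Nf → ℝ) : Prop :=
  ∀ (R R' : ℕ) (A : QCDLatticeObservable Nf R) (B : QCDLatticeObservable Nf R'),
    ∃ (N : ℕ) (Rd Rd' : Fin N → ℕ) (Ad : ∀ i, QCDLatticeObservable Nf (Rd i))
      (Bd : ∀ i, QCDLatticeObservable Nf (Rd' i)) (K : ℝ), 0 ≤ K ∧
      ∀ᶠ k in atTop, ∀ S : ℕ, (reg.scheme m' 0 0).L k ≤ S → ∀ n : ℕ, n ≤ S →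
        ‖qcdLatticeConnectedCorr ((reg.scheme m' 0 0).β k) (2 * S + 1)
            (fun fl => (reg.scheme m' 0 0).mq fl k) A B n‖ ≤
          K * ∑ i, ‖qcdLatticeConnectedCorr ((reg.scheme m 0 0).β k) (2 * S + 1)
            (fun fl => (reg.scheme m 0 0).mq fl k) (Ad i) (Bd i) n‖

/-- The crux's certificate hypothesis is `RayCertificate` (definitional read-back). [folklore] -/
theorem rayCertificate_iff {Nf : ℕ} (reg : QCDRegularisation Nf) (m : Fin Nf → ℝ) :
    RayCertificate Nf reg m ↔
      ∀ᶠ k in Filter.atTop, ∀ t : ℝ, 0 ≤ t → ∃ δ : ℝ, 0 < δ ∧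
        ∀ (R R' : ℕ) (A : QCDLatticeObservable Nf R) (B : QCDLatticeObservable Nf R'),
          ∃ (C : ℝ) (S₀ : ℕ), ∀ S : ℕ, S₀ ≤ S → ∀ n : ℕ, n ≤ S →
            ‖qcdLatticeConnectedCorr (reg.β k) (2 * S + 1) (fun f => (reg.scheme m 0 0).mq f k + t) A B n‖ ≤
              C * Real.exp (-(δ * n)) :=
  Iff.rfl

/-! ## §1 The three stub statements

Naming (for `ledger skeleton check` / `#h21_check_skeleton`): the statement of the registered stub `stub_<name>` is
the `def Stmt.stub_<name> : Prop` below, so that every hypothesis of the composition `LatticeGapMonotone_of` is headed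
by a constant whose short name IS a declared stub (crux workfiles may not carry the gate-reserved `@[stub]` tag, and an
inline signature has no head constant).  Prose names: (S1) MassivePhaseUpSet / (S2) SegmentUniformity /
(S3) UniformDomination. -/

/-- **(S1) The certified massive phase is an up-set of the componentwise order** (phase structure of Wilson lattice
QCD at fixed coupling; size L, open at weak coupling).  For every `N_f`, regularisation `reg` and tuples
`m ≤ m''` componentwise: if the flavour-blind ray above `m`'s bare tuple clusters `S`-uniformly at every large `k`
(`RayCertificate reg m`), so does the ray above the bare tuple of `m''`.  Why plausibly true: raising bare Wilson
masses at fixed `β` moves AWAY from the chiral critical surface `m_f = m_c(β)` and from the Aoki / Sharpe–Singleton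
structures attached to it (whose width shrinks with the mass), towards the heavy corner where the hopping expansion
converges for every split tuple; for a flavour-BLIND raise `m'' = m + c·1` it is a tautology (the ray above
`m''(k)` is the tail `t ≥ a_k c / Z_m(k)` of the ray above `m(k)`).  Why it might fail: a SPLIT raise leaves the
certified diagonal ray — e.g. `N_f = 2` with `m_u'' ≫ m_d'' = m_d` is effectively `N_f = 1 + heavy` at `β_k`, whose
first-order line / endpoint near `m_c` sits elsewhere than the `N_f = 2` Aoki fingers, so clustering on the ray above
`m(k)` says nothing logical about the ray above `m''(k)`; at weak coupling no expansion certifies either ray; as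
typed `β_k` is any real sequence.  Size: L / open. -/
def Stmt.stub_massivePhaseUpSet : Prop :=
  ∀ (Nf : ℕ) (reg : QCDRegularisation Nf) (m m'' : Fin Nf → ℝ), (∀ f, m f ≤ m'' f) →
    RayCertificate Nf reg m → RayCertificate Nf reg m''

/-- **(S2) Pointwise certificates on an order segment uniformise** (stability of `S`-uniform clustering in the bare
mass + compactness of the segment; size M–L).  For `m ≤ m'` componentwise: if EVERY tuple `m''` of the segment
`m ≤ m'' ≤ m'` carries its own ray certificate (each with its own threshold `k₀(m'')`, rates `δ(k, t, m'')` and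
per-pair constants), then the segment is certified UNIFORMLY (`SegmentCertificate reg m m'`: one `k₀`; at each
`k ≥ k₀` one rate `δ_k > 0` and per-pair `(C, S₀)` serving every `m''` in the segment).  Why plausibly true: at fixed
`k` the bare segment `{m''(k)}` is a compact box; exponential clustering of a massive lattice theory is an OPEN
condition in the bare masses with locally uniform rate and constants (convergent perturbation / polymer expansion
about a theory with a spectral gap; analyticity of `qcdTorusExpect` in `mq` at fixed volume), so finitely many
neighbourhoods cover the box.  Why it might fail: the `S`-UNIFORM openness needs the gap itself as input (finite-volume
perturbation theory is not uniform in `S` without it) — a stability theorem for Wilson lattice QCD in the massive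
phase that is not in print at weak coupling; the certificate's `k`-threshold is per tuple and the eventuality sets
need not be open in `m''`, so one `k₀` for the whole segment is extra content; rates `δ(m'')` positive everywhere
need not be bounded below if `m'' ↦ δ*(m'')` fails to be lower semicontinuous at a higher-order transition inside
the segment.  Size: M–L. -/
def Stmt.stub_segmentUniformity : Prop :=
  ∀ (Nf : ℕ) (reg : QCDRegularisation Nf) (m m' : Fin Nf → ℝ), (∀ f, m f ≤ m' f) →
    (∀ m'' : Fin Nf → ℝ, (∀ f, m f ≤ m'' f) → (∀ f, m'' f ≤ m' f) → RayCertificate Nf reg m'') →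
      SegmentCertificate Nf reg m m'

/-- **(S3) Uniform domination up a certified segment** (the analytic heart: the header's UniformDomination with
the SEA sign — association of long-distance correlators with `Tr G_f` under the unquenched measure, the
"paramagnetic effect of light quark loops", Δβ = +24K⁴N_f(1+2r²−r⁴) in the convergent corner — and the VALENCE sign
`∂_{m₀}(G†G) = −2G†(m₀+W)G ≤ 0 on average` folded in, plus the `(−1)^F`-twisted finite-torus bookkeeping and
Cauchy–Schwarz from diagonal to general pairs; size XL).  For `m ≤ m'` componentwise with a uniform segment
certificate: every pair `(A, B)` is dominated at the heavier tuple by finitely many pairs at the lighter tuple with a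
constant `K ≥ 0` independent of `(k, S, n)` (`UniformlyDominated reg m m'`).  Why plausibly true: by the exact
Berezin identity `∂_{m_f}⟨X⟩ = −Cov(X, Σ_f)` (support item MassDerivativeIdentity) the logarithmic mass derivative of
an RP-diagonal correlator `c_A(n) = ⟨θA·τ_nA⟩` is (valence) + (sea covariance), both `≤ 0` uniformly in `n` on the
physical branch ("every level carries at least the vacuum's scalar density"); integrating along the certified segment
gives `c_A(n; m'(k)) ≤ K_A c_A(n; m(k))`, and `|⟨θA'·τ_nB'⟩^c| ≤ (c_{A'}(n) + c_{B'}(n))/2` reduces general pairs to two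
diagonal ones; `K_A` is `k`-uniform because the bare increments `a_k(m'_f − m_f)/Z_m(k)` stay bounded (→ 0 under
`HasMassScaling`).  Why it might fail: the sea sign is an association inequality in many Dirac-eigenvalue variables
and can reverse (anti-bag levels; flavour-singlet `0⁺⁺`/`η'` channels where hairpins dominate; Nussinov–Lampert
§20.1); split or odd-`N_f` Wilson weights are SIGNED, so no FKG/positivity proof of the covariance sign is available
and `qcdTorusExpect` is junk `0` where the fermionic partition function vanishes — at the LIGHTER tuple this kills the
dominating family at that `(k, S)` while the heavier correlator need not vanish; RP-diagonal positivity is not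
configuration-wise on the time-periodic torus (`(−1)^F`-twisted trace), so the Cauchy–Schwarz step needs the
transfer-matrix form and wrap-around control down to `S = L_k`; without `HasMassScaling` (not a hypothesis of the
crux) the bare increments may diverge and `K` need not stay bounded in `k`.  Size: XL. -/
def Stmt.stub_uniformDomination : Prop :=
  ∀ (Nf : ℕ) (reg : QCDRegularisation Nf) (m m' : Fin Nf → ℝ), (∀ f, m f ≤ m' f) →
    SegmentCertificate Nf reg m m' → UniformlyDominated Nf reg m m'

/-! ## §2 The registered stubs (the ONLY `sorry`s of this file) -/

/-- (S1) the certified massive phase is an up-set of the componentwise order — size L / open. -/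
theorem stub_massivePhaseUpSet : Stmt.stub_massivePhaseUpSet := by
  sorry

/-- (S2) pointwise certificates on an order segment uniformise — size M–L. -/
theorem stub_segmentUniformity : Stmt.stub_segmentUniformity := by
  sorry

/-- (S3) uniform domination up a certified segment — size XL (the analytic heart). -/
theorem stub_uniformDomination : Stmt.stub_uniformDomination := by
  sorry

/-! ## §3 Composition (kernel-checked; no `sorry` below this line) -/

/-- **Bookkeeping: uniform domination transports every uniform lattice gap, with the same rate.**  If `m'` is
uniformly dominated by `m` along `reg`, then `(reg.scheme m 0 0).HasLatticeMassGap Δ` gives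
`(reg.scheme m' 0 0).HasLatticeMassGap Δ` for EVERY `Δ` (constant `K · ∑ᵢ Cᵢ`; the finitely many eventualities of the
dominating family are intersected by `Filter.eventually_all`; the fields `β, L, a` of the two schemes agree with
`reg`'s definitionally). [folklore] -/
theorem hasLatticeMassGap_of_dominated {Nf : ℕ} (reg : QCDRegularisation Nf) (m m' : Fin Nf → ℝ)
    (h : UniformlyDominated Nf reg m m') {Δ : ℝ} (hg : (reg.scheme m 0 0).HasLatticeMassGap Δ) :
    (reg.scheme m' 0 0).HasLatticeMassGap Δ := by
  intro R R' A B
  obtain ⟨N, Rd, Rd', Ad, Bd, K, hK, hdom⟩ := h R R' A B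
  choose C hC using fun i : Fin N => hg (Rd i) (Rd' i) (Ad i) (Bd i)
  refine ⟨K * ∑ i, C i, ?_⟩
  have hall : ∀ᶠ k in atTop, ∀ i : Fin N, ∀ S : ℕ, (reg.scheme m 0 0).L k ≤ S → ∀ n : ℕ, n ≤ S →
      ‖qcdLatticeConnectedCorr ((reg.scheme m 0 0).β k) (2 * S + 1)
          (fun fl => (reg.scheme m 0 0).mq fl k) (Ad i) (Bd i) n‖ ≤
        C i * Real.exp (-(Δ * ((reg.scheme m 0 0).a k * n))) :=
    eventually_all.2 hC
  filter_upwards [hdom, hall] with k hk hk' S hS n hn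
  have hS' : (reg.scheme m 0 0).L k ≤ S := hS
  calc ‖qcdLatticeConnectedCorr ((reg.scheme m' 0 0).β k) (2 * S + 1)
          (fun fl => (reg.scheme m' 0 0).mq fl k) A B n‖
        ≤ K * ∑ i, ‖qcdLatticeConnectedCorr ((reg.scheme m 0 0).β k) (2 * S + 1)
            (fun fl => (reg.scheme m 0 0).mq fl k) (Ad i) (Bd i) n‖ := hk S hS n hn
    _ ≤ K * ∑ i, C i * Real.exp (-(Δ * ((reg.scheme m 0 0).a k * n))) :=
        mul_le_mul_of_nonneg_left (Finset.sum_le_sum fun i _ => hk' i S hS' n hn) hK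
    _ = (K * ∑ i, C i) * Real.exp (-(Δ * ((reg.scheme m 0 0).a k * n))) := by
        rw [mul_assoc, Finset.sum_mul]

/-- **The crux from the three stubs** (concludes `LatticeGapMonotone` BY NAME).  The crux's hypothesis is the ray
certificate of `m`; (S1) spreads it to every tuple of the order segment `[m, m']`; (S2) uniformises the segment;
(S3) dominates `m'` by `m`; the bookkeeping lemma moves the gap `Δ` up with the same rate. -/
theorem LatticeGapMonotone_of :
    Stmt.stub_massivePhaseUpSet → Stmt.stub_segmentUniformity → Stmt.stub_uniformDomination →
      LatticeGapMonotone := by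
  intro hUp hSeg hDom
  unfold LatticeGapMonotone
  intro Nf reg m m' Δ hle hcert hgap
  have hray : RayCertificate Nf reg m := (rayCertificate_iff reg m).2 hcert
  have hseg : SegmentCertificate Nf reg m m' :=
    hSeg Nf reg m m' hle (fun m'' h₁ _ => hUp Nf reg m m'' h₁ hray)
  exact hasLatticeMassGap_of_dominated reg m m' (hDom Nf reg m m' hle hseg) hgap

/-! ## §4 Special case (BC5-in-kind): `N_f = 0` -/

/-- With no flavours the two schemes coincide (`Fin 0 → ℝ` is a subsingleton) and the crux's conclusion holds with
no certificate at all: the definitions compute. [folklore] -/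
theorem latticeGapMonotone_nf_zero (reg : QCDRegularisation 0) (m m' : Fin 0 → ℝ) (Δ : ℝ)
    (h : (reg.scheme m 0 0).HasLatticeMassGap Δ) : (reg.scheme m' 0 0).HasLatticeMassGap Δ := by
  obtain rfl : m = m' := Subsingleton.elim _ _
  exact h

/-- The `N_f = 0` instance of every currency predicate is likewise degenerate: a tuple dominates itself
(family `{(A, B)}`, `K = 1`). [folklore] -/
theorem uniformlyDominated_self {Nf : ℕ} (reg : QCDRegularisation Nf) (m : Fin Nf → ℝ) :
    UniformlyDominated Nf reg m m := by
  intro R R' A B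
  refine ⟨1, fun _ => R, fun _ => R', fun _ => A, fun _ => B, 1, zero_le_one, ?_⟩
  refine Filter.Eventually.of_forall fun k S _ n _ => ?_
  simp

end Summit.QuantumFields.QCD.Cruxes.LatticeGapMonotone.Birth

end
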